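import Literature.Probability.Percolation.LongRangeBridges
import HarnessLib

/-!
# Long-range bond percolation on `ℤ`: untouched windows and the final-step lemma

Topic `Literature/Probability/Percolation`; third deterministic companion of
`LongRangeOneDim.lean` / `LongRangeBridges.lean` (Duminil-Copin–Garban–Tassion, *Long-range
models in 1D revisited*, AIHP 60 (2024), arXiv:2011.04642, §2.4).

## Contents (all proved)

* `touched_iff_of_agree`, `jumpBridged_iff_of_agree` — configurations agreeing off the short
  edges of untouched windows have the same `touched`/`jumpBridged` events (the finitary content
  of DGT's "conditionally on `X`, whether a block `B ∈ 𝐁` is `K`-crossed or not is independent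
  of the other blocks in `𝐁`", proof of Lemma 3);
* `longEdges K`, `longClosed K` (DGT's `B(K)`), `escape K` (DGT's `A(K)`),
  `percolatesAt_subset_escape`, and the final-step lemma `escape_subset`:
  `A(K) ⊆ B(K)ᶜ ∪ cross K (6K) ∪ cross K (-6K)` (proof of Thm. 1(ii): "if `B(K_n)` occurs and
  neither `B^{-2}_{3K_n}` nor `B^{2}_{3K_n}` is `K_n`-crossed, then `A(K_n)` does not occur").

## References

* H. Duminil-Copin, C. Garban, V. Tassion, *Long-range models in 1D revisited*, Ann. Inst.
  H. Poincaré Probab. Statist. 60 (2024), arXiv:2011.04642: §2.4 (proof of Thm. 1(ii), Lemma 3).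
-/

namespace Literature.Probability.Percolation

open SimpleGraph

/-! ### Transfer of `touched` / `jumpBridged` between configurations agreeing off short edges -/

/-- `touched` only looks at edges of length `> K`: configurations agreeing on all edges of
length `> K` are touched together. [folklore] -/
theorem touched_iff_of_agree {K L R : ℕ} {c : ℤ} {ω ω' : BondConfig ℤ}
    (h : ∀ f : Sym2 ℤ, K < edgeLen f → (f ∈ ω ↔ f ∈ ω')) :
    ω ∈ touched K L R c ↔ ω' ∈ touched K L R c := by
  constructor
  · rintro ⟨e, he, hK, hL, z, hz, hz'⟩; exact ⟨e, (h e hK).1 he, hK, hL, z, hz, hz'⟩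
  · rintro ⟨e, he, hK, hL, z, hz, hz'⟩; exact ⟨e, (h e hK).2 he, hK, hL, z, hz, hz'⟩

/-- **Bridges over untouched windows do not see the short edges of those windows.** Let `S` be
a set of edges contained in the union of the windows `windowEdges K c''`, `c'' ∈ Cs`, and let
`ω, ω'` agree off `S`. If no window `c'' ∈ Cs` is touched in `ω`, then `ω` and `ω'` have the
same mid-range bridges, hence `jumpBridged K L R c` agrees for every centre `c`. (The
determining set `bridgeEdges L R x y` of a mid-range open edge `{x, y}` avoids every
`windowEdges K c''`: its endpoints are at distance `> 4K + R` from `c''`.)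
[cite: DuminilcopinGarbanTassion2024, §2.4 (proof of Lemma 3, conditioning on X)] -/
theorem jumpBridged_iff_of_agree {K L R : ℕ} {Cs : Set ℤ} {S : Set (Sym2 ℤ)}
    (hS : S ⊆ ⋃ c'' ∈ Cs, windowEdges K c'') {ω ω' : BondConfig ℤ}
    (h : ∀ f : Sym2 ℤ, f ∉ S → (f ∈ ω ↔ f ∈ ω')) (hU : ∀ c'' ∈ Cs, ω ∉ touched K L R c'')
    (c : ℤ) :
    ω ∈ jumpBridged K L R c ↔ ω' ∈ jumpBridged K L R c := by
  -- edges of length `> K` are not in `S`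
  have hlong : ∀ f : Sym2 ℤ, K < edgeLen f → f ∉ S := by
    intro f hf hfS
    obtain ⟨c'', -, hfc⟩ := Set.mem_iUnion₂.1 (hS hfS)
    exact absurd hfc.1 (not_le.2 hf)
  -- for an open mid-range edge `{x, y}` of `ω`, `bridgeEdges` avoids `S`
  have hkey : ∀ x y : ℤ, s(x, y) ∈ ω → K < edgeLen s(x, y) → edgeLen s(x, y) ≤ L →
      ω ∩ bridgeEdges L R x y = ω' ∩ bridgeEdges L R x y := by
    intro x y hω hK hL
    -- the endpoints are far from every centre of `Cs`
    have hfar : ∀ w : ℤ, (w = x ∨ w = y) → ∀ c'' ∈ Cs,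
        ¬ (c'' - (4 * K + R) ≤ w ∧ w ≤ c'' + (4 * K + R)) := by
      intro w hw c'' hc'' hwc
      refine hU c'' hc'' ⟨s(x, y), hω, hK, hL, w, ?_, hwc⟩
      rcases hw with rfl | rfl <;> simp
    ext f
    simp only [Set.mem_inter_iff]
    suffices hf : f ∈ bridgeEdges L R x y → f ∉ S by
      constructor
      · rintro ⟨h1, h2⟩; exact ⟨(h f (hf h2)).1 h1, h2⟩
      · rintro ⟨h1, h2⟩; exact ⟨(h f (hf h2)).2 h1, h2⟩
    rintro (hf | ⟨hf, -⟩) hfS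
    · rw [Set.mem_singleton_iff] at hf
      exact hlong f (hf ▸ hK) hfS
    · obtain ⟨c'', hc'', hfc⟩ := Set.mem_iUnion₂.1 (hS hfS)
      -- `f` touches the ball of `x` or of `y` and lies in the window of `c''`
      have hw : ∃ w : ℤ, (w = x ∨ w = y) ∧ ∃ z ∈ f, w - R ≤ z ∧ z ≤ w + R := by
        rcases hf with ⟨z, hz, hz'⟩ | ⟨z, hz, hz'⟩
        · exact ⟨x, Or.inl rfl, z, hz, hz'⟩
        · exact ⟨y, Or.inr rfl, z, hz, hz'⟩
      obtain ⟨w, hw, z, hzf, hz⟩ := hw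
      have hzc := hfc.2 z hzf
      exact hfar w hw c'' hc'' (by omega)
  constructor
  · rintro ⟨x, y, hx, hy, hL, hb⟩
    refine ⟨x, y, hx, hy, hL, ?_⟩
    have hK : K < edgeLen s(x, y) := by rw [lt_edgeLen_mk_iff]; omega
    have hL' : edgeLen s(x, y) ≤ L := by rw [edgeLen_mk_le_iff]; omega
    exact ((determinedBy_iff _ _).1 (determinedBy_isLongBridge L R x y) ω ω'
      (hkey x y hb.1 hK hL')).1 hb
  · rintro ⟨x, y, hx, hy, hL, hb⟩
    refine ⟨x, y, hx, hy, hL, ?_⟩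
    have hK : K < edgeLen s(x, y) := by rw [lt_edgeLen_mk_iff]; omega
    have hL' : edgeLen s(x, y) ≤ L := by rw [edgeLen_mk_le_iff]; omega
    have hω : s(x, y) ∈ ω := (h _ (hlong _ hK)).2 hb.1
    exact ((determinedBy_iff _ _).1 (determinedBy_isLongBridge L R x y) ω ω'
      (hkey x y hω hK hL')).2 hb

/-! ### The final-step lemma: escaping `[-9K, 9K]` -/

/-- The edges of length `> K` with an endpoint in `[-9K, 9K]` (countably many).
[cite: DuminilcopinGarbanTassion2024, §2.4 (event B(K_n))] -/
def longEdges (K : ℕ) : Set (Sym2 ℤ) :=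
  {e | K < edgeLen e ∧ ∃ z ∈ e, -(9 * K : ℤ) ≤ z ∧ z ≤ 9 * K}

/-- **`B(K)`**: all edges of length `> K` with an endpoint in `[-9K, 9K]` are closed (DGT20,
proof of Thm. 1(ii)). [cite: DuminilcopinGarbanTassion2024, §2.4 (event B(K_n))] -/
def longClosed (K : ℕ) : Set (BondConfig ℤ) :=
  {ω | ∀ e ∈ longEdges K, e ∉ ω}

/-- **`A(K)`**: some `x ∈ [-3K, 3K]` is joined by an open path to some site outside `[-9K, 9K]`
(DGT20, proof of Thm. 1(ii)). [cite: DuminilcopinGarbanTassion2024, §2.4 (event A(K_n))] -/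
def escape (K : ℕ) : Set (BondConfig ℤ) :=
  {ω | ∃ x z : ℤ, (-(3 * K : ℤ) ≤ x ∧ x ≤ 3 * K) ∧ ¬ (-(9 * K : ℤ) ≤ z ∧ z ≤ 9 * K) ∧
    (openGraph ω).Reachable x z}

/-- A site of `[-3K, 3K]` in an infinite cluster escapes `[-9K, 9K]`. [folklore] -/
theorem percolatesAt_subset_escape {K : ℕ} {x : ℤ} (hx : -(3 * K : ℤ) ≤ x ∧ x ≤ 3 * K) :
    percolatesAt x ⊆ escape K := by
  intro ω hω
  by_contra hno
  refine hω ((Set.finite_Icc (-(9 * K : ℤ)) (9 * K)).subset fun z hz => ?_)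
  by_contra hz'
  exact hno ⟨x, z, hx, fun h => hz' ⟨h.1, h.2⟩, hz⟩

/-- **Final-step lemma** (DGT20, proof of Thm. 1(ii): "if `B(K_n)` occurs and neither
`B^{-2}_{3K_n}` nor `B^{2}_{3K_n}` is `K_n`-crossed, then `A(K_n)` does not occur"): on
`longClosed K`, an escape from `[-3K, 3K]` out of `[-9K, 9K]` uses only edges of length `≤ K`
up to its first exit and therefore crosses the block centred at `6K` or the one centred at
`-6K`. [cite: DuminilcopinGarbanTassion2024, §2.4 (proof of Thm. 1(ii))] -/
theorem escape_subset (K : ℕ) :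
    escape K ⊆ (longClosed K)ᶜ ∪ cross K (6 * K) ∪ cross K (-(6 * K)) := by
  intro ω hω
  by_contra hnot
  simp only [Set.mem_union, Set.mem_compl_iff, not_or, not_not] at hnot
  obtain ⟨⟨hB, hX⟩, hX'⟩ := hnot
  obtain ⟨x, z, hx, hz, hr⟩ := hω
  set Hp := openGraph (ω ∩ windowEdges K (6 * K)) with hHp
  set Hm := openGraph (ω ∩ windowEdges K (-(6 * K))) with hHm
  set S : Set ℤ := {v | -(3 * K : ℤ) ≤ v ∧ v ≤ 3 * K} ∪
    ({v | (3 * K : ℤ) < v ∧ v ≤ 9 * K ∧ ∃ x' : ℤ, x' ≤ 3 * K ∧ Hp.Reachable x' v} ∪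
     {v | v < -(3 * K : ℤ) ∧ -(9 * K : ℤ) ≤ v ∧ ∃ x' : ℤ, -(3 * K : ℤ) ≤ x' ∧ Hm.Reachable x' v})
    with hS
  -- every open edge touching `[-9K, 9K]` is short
  have hshort : ∀ a b : ℤ, s(a, b) ∈ ω → (-(9 * K : ℤ) ≤ a ∧ a ≤ 9 * K) →
      a - b ≤ K ∧ b - a ≤ K := by
    intro a b hab ha
    by_contra hlong
    refine hB s(a, b) ⟨?_, a, by simp, ha⟩ hab
    rw [lt_edgeLen_mk_iff]; omega
  have hclosed : ∀ a b : ℤ, s(a, b) ∈ hr.some.edges → a ∈ S → b ∈ S := by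
    intro a b hab ha
    have hadj := hr.some.adj_of_mem_edges hab
    rw [openGraph_adj] at hadj
    obtain ⟨habω, hne⟩ := hadj
    have ha' : (-(3 * K : ℤ) ≤ a ∧ a ≤ 3 * K) ∨
        (((3 * K : ℤ) < a ∧ a ≤ 9 * K ∧ ∃ x' : ℤ, x' ≤ 3 * K ∧ Hp.Reachable x' a) ∨
         (a < -(3 * K : ℤ) ∧ -(9 * K : ℤ) ≤ a ∧ ∃ x' : ℤ, -(3 * K : ℤ) ≤ x' ∧ Hm.Reachable x' a)) :=
      ha
    have ha9 : -(9 * K : ℤ) ≤ a ∧ a ≤ 9 * K := by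
      rcases ha' with h | ⟨h, h', -⟩ | ⟨h, h', -⟩ <;> omega
    have hlen := hshort a b habω ha9
    -- adjacency in the two window graphs, when the edge lies in the window
    have hHp : (2 * K : ℤ) ≤ a → a ≤ 10 * K → (2 * K : ℤ) ≤ b → b ≤ 10 * K → Hp.Adj a b := by
      intro h1 h2 h3 h4
      rw [hHp, openGraph_adj]
      refine ⟨⟨habω, (mk_mem_windowEdges_iff _ _ _ _).2 ⟨hlen, ?_, ?_⟩⟩, hne⟩ <;> omega
    have hHm : -(10 * K : ℤ) ≤ a → a ≤ -(2 * K : ℤ) → -(10 * K : ℤ) ≤ b → b ≤ -(2 * K : ℤ) →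
        Hm.Adj a b := by
      intro h1 h2 h3 h4
      rw [hHm, openGraph_adj]
      refine ⟨⟨habω, (mk_mem_windowEdges_iff _ _ _ _).2 ⟨hlen, ?_, ?_⟩⟩, hne⟩ <;> omega
    -- case analysis on the position of `b`
    by_cases hb3 : -(3 * K : ℤ) ≤ b ∧ b ≤ 3 * K
    · exact Or.inl hb3
    rcases ha' with h | ⟨h, h', x', hx', hr'⟩ | ⟨h, h', x', hx', hr'⟩
    · -- `a` in the core, `b` just outside: `b` is reached from `a` inside a window
      by_cases hb : (3 * K : ℤ) < b
      · refine Or.inr (Or.inl ⟨hb, by omega, a, h.2, (hHp ?_ ?_ ?_ ?_).reachable⟩) <;> omega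
      · refine Or.inr (Or.inr ⟨by omega, by omega, a, h.1, (hHm ?_ ?_ ?_ ?_).reachable⟩) <;>
          omega
    · -- `a` in `(3K, 9K]`, reached from `x' ≤ 3K` in the window of `6K`
      have hab' : Hp.Adj a b := by refine hHp ?_ ?_ ?_ ?_ <;> omega
      by_cases hb : b ≤ 9 * K
      · exact Or.inr (Or.inl ⟨by omega, hb, x', hx', hr'.trans hab'.reachable⟩)
      · -- `b > 9K`: the block centred at `6K` is crossed
        exact absurd ⟨x', b, by omega, by omega, hr'.trans hab'.reachable⟩ hX
    · have hab' : Hm.Adj a b := by refine hHm ?_ ?_ ?_ ?_ <;> omega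
      by_cases hb : -(9 * K : ℤ) ≤ b
      · exact Or.inr (Or.inr ⟨by omega, hb, x', hx', hr'.trans hab'.reachable⟩)
      · -- `b < -9K`: the block centred at `-6K` is crossed, read from `b` to `x'`
        refine absurd ⟨b, x', by omega, by omega, (hr'.trans hab'.reachable).symm⟩ hX'
  have hzS : (-(3 * K : ℤ) ≤ z ∧ z ≤ 3 * K) ∨
      (((3 * K : ℤ) < z ∧ z ≤ 9 * K ∧ ∃ x' : ℤ, x' ≤ 3 * K ∧ Hp.Reachable x' z) ∨
       (z < -(3 * K : ℤ) ∧ -(9 * K : ℤ) ≤ z ∧ ∃ x' : ℤ, -(3 * K : ℤ) ≤ x' ∧ Hm.Reachable x' z)) :=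
    hr.some.mem_of_edges_closed (S := S) (Or.inl hx) hclosed
  rcases hzS with h | ⟨h, h', -⟩ | ⟨h, h', -⟩ <;> omega

end Literature.Probability.Percolation
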